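import Literature.AlgebraicGeometry.Resolution.ResolutionOfSingularities
import Mathlib.RingTheory.Regular.RegularSequence
import HarnessLib

/-!
# Macaulayfication (Kawasaki 2000; Česnavičius 2021) — named fact

Topic: `Literature/AlgebraicGeometry/Resolution`. The "rung below resolution": every scheme separated and
of finite type over a Noetherian ring with a dualizing complex admits a **Macaulayfication**, i.e. a proper
birational morphism from a Cohen–Macaulay scheme (Faltings 1978 for non-CM locus of dimension `≤ 1`;
Kawasaki 2000 in general; Česnavičius 2021 for all CM-quasi-excellent Noetherian schemes, with the
morphism projective and an isomorphism over the Cohen–Macaulay locus). Vendored here, as a NAMED FACT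
(`def … : Prop`, not proved in the tree), in the special case and vocabulary used by route
`FrobeniusLadder` of summit `ResolutionOfSingularities` (crux `FInjectiveMacaulayfication`, whose registered
stub `stub_kawasakiIntegral` is the universe-`0` instance of `KawasakiMacaulayfication`):

* base = a field `k` (fields have dualizing complexes, Stacks 0BFR; finite-type `k`-schemes are excellent,
  Stacks 07QW, hence CM-excellent, Česnavičius 2021 Ex. 1.3);
* `X` INTEGRAL (the reduced case follows by Macaulayfying the finitely many integral components and taking
  the disjoint union — done on the summit side, `Summit…Theorems.FInjectiveMacaulayfication.stub_cmGlue`);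
* "birational" = `IsBirational` of this directory (a dense open `U ⊆ X` with dense preimage over which the
  map is an isomorphism) — exactly Kawasaki 2000 Thm 5.1 (1)–(3), and Česnavičius 2021 Thm 5.3 (iii)–(iv)
  with `U = CM(X)`;
* "`X₁` Cohen–Macaulay" is spelled stalkwise and WITHOUT a Cohen–Macaulay predicate (the tree has none, cf.
  `CohenMacaulayUnmixed.lean`): at every point `x ∈ X₁`, every system of parameters of `𝒪_{X₁,x}` — `d =
  dim 𝒪_{X₁,x}` elements generating an ideal whose radical is maximal — is a weakly regular sequence
  (Mathlib `RingTheory.Sequence.IsWeaklyRegular`; for elements of the maximal ideal weakly regular = regular).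
  For a Noetherian local ring this is equivalent to Cohen–Macaulayness (Bruns–Herzog Thm 2.1.2 (d): in a CM
  local ring every s.o.p. is a regular sequence; conversely a regular s.o.p. gives `depth = dim`), and a
  scheme is Cohen–Macaulay iff all its local rings are (Stacks 02IP; localizations of CM local rings are CM,
  Bruns–Herzog Thm 2.1.3 (b)), so the clause at ALL points (closed or not) is what the sources give;
* "`X₁` integral": for integral `X` of finite type over `k` (CM-excellent, locally equidimensional)
  Česnavičius 2021 Thm 5.3 gives `X₁ = Bl_Z(X)` for a closed `Z` disjoint from the dense open `CM(X)`, and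
  the blow-up of an integral scheme in a non-zero ideal is integral (Stacks 02ND); equivalently, from
  Kawasaki's Thm 5.1 (1)–(3): `X₁` is CM hence `(S₁)`, contains the integral dense open `π₁⁻¹(U) ≅ U`,
  hence is irreducible and generically reduced, hence reduced (Stacks 0344).

## Sources

* T. Kawasaki, *On Macaulayfication of Noetherian schemes*, Trans. Amer. Math. Soc. 352 (2000) 2517–2552:
  Definition (§1, p. 2517) "Let X be a Noetherian scheme. A birational proper morphism Y → X is said to be
  a Macaulayfication of X if Y is a Cohen–Macaulay scheme."; **Theorem 1.1** (p. 2518) "Let A be a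
  Noetherian ring possessing a dualizing complex and X a separated, of finite type scheme over Spec A. Then
  X has a Macaulayfication."; Theorem 5.1 (p. 2538) (the meaning of birational: dense open `U`, `f⁻¹(U)`
  dense in `Y`, `f` an isomorphism over `U`).
* K. Česnavičius, *Macaulayfication of Noetherian schemes*, Duke Math. J. 170 (2021) 1419–1455 =
  arXiv:1810.04493v2: **Theorem 1.6** "For every CM-quasi-excellent, Noetherian scheme X, there are a
  Cohen–Macaulay scheme X̃ and a birational, projective morphism π : X̃ → X that is an isomorphism over the
  Cohen–Macaulay locus CM(X) ⊂ X."; Definition 1.2, Example 1.3, Theorem 5.3, Remark 5.4.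
* G. Faltings, *Über Macaulayfizierung*, Math. Ann. 238 (1978) 175–192 (the notion; non-CM locus of
  dimension ≤ 1).
* W. Bruns, J. Herzog, *Cohen–Macaulay rings*, rev. ed., CUP 1998, Def. 2.1.1, Thm 2.1.2 (d), Thm 2.1.3 (b).
* The Stacks Project, Tags 0BFR, 07QW, 02IP, 02OS, 07ZU, 02ND, 0344.

## What is NOT here

The proof (Kawasaki's p-standard systems of parameters and the blow-up of `∏ (x_i,…,x_d)`; Česnavičius's
Noetherian induction with the special fibre as first hypersurface) — an XL formalization project; the
general base (Noetherian `A` with a dualizing complex / CM-quasi-excellent `X`); projectivity of `π₁` and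
"isomorphism over all of `CM(X)`" (available verbatim from Česnavičius Thm 5.3 / Rem 5.4 if ever needed —
`-- TODO(general form)` below); a Cohen–Macaulay predicate for local rings / schemes (deliberately not
introduced here; the clause is inline, in the form the route's cruxes use).
-/

noncomputable section

open CategoryTheory AlgebraicGeometry

namespace Literature.AlgebraicGeometry.Resolution

universe u

/-- NAMED FACT — **Macaulayfication of integral schemes of finite type over a field** (Kawasaki 2000,
Thm 1.1, special case `A = k` a field, `X` integral; also Česnavičius 2021, Thm 1.6 / Thm 5.3): for every
field `k` and every integral scheme `X` separated and of finite type over `k` there are a scheme `X₁` and a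
proper morphism `π₁ : X₁ → X`, birational (an isomorphism over a dense open of `X` with dense preimage), with
`X₁` integral and all local rings `𝒪_{X₁,x}` Cohen–Macaulay — spelled: every system of parameters of
`𝒪_{X₁,x}` (`d = dim 𝒪_{X₁,x}` elements generating an ideal with maximal radical) is a weakly regular
sequence (Bruns–Herzog Thm 2.1.2 (d)). Users take `(h : KawasakiMacaulayfication)`.
-- TODO(general form): X separated of finite type over a Noetherian ring with a dualizing complex (Kawasaki
-- Thm 1.1), resp. X CM-quasi-excellent Noetherian with π projective and an isomorphism over CM(X)
-- (Česnavičius Thm 1.6).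
[cite: Kawasaki2000, Thm 1.1] -/
def KawasakiMacaulayfication : Prop :=
  ∀ (k : Type u) [Field k] (X : Scheme.{u}) (f : X ⟶ Spec (.of k)),
    IsSeparated f → LocallyOfFiniteType f → QuasiCompact f → IsIntegral X →
      ∃ (X₁ : Scheme.{u}) (π₁ : X₁ ⟶ X), IsProper π₁ ∧ IsBirational π₁ ∧ IsIntegral X₁ ∧
        ∀ x : X₁, ∀ d : ℕ, ringKrullDim (X₁.presheaf.stalk x) = d →
          ∀ s : Fin d → X₁.presheaf.stalk x, (Ideal.span (Set.range s)).radical.IsMaximal →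
            RingTheory.Sequence.IsWeaklyRegular (X₁.presheaf.stalk x) (List.ofFn s)

/-- A regular scheme is its own Macaulayfication in the weak sense that needs no input: the statement
`KawasakiMacaulayfication` is consistent with (indeed implied objectwise by) resolution of singularities —
recorded here only as the trivial instance "`X₁ = X` works when every local ring of `X` already satisfies
the clause". [folklore] -/
theorem kawasakiMacaulayfication_of_self (X : Scheme.{u}) [IsIntegral X]
    (hX : ∀ x : X, ∀ d : ℕ, ringKrullDim (X.presheaf.stalk x) = d →
      ∀ s : Fin d → X.presheaf.stalk x, (Ideal.span (Set.range s)).radical.IsMaximal →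
        RingTheory.Sequence.IsWeaklyRegular (X.presheaf.stalk x) (List.ofFn s)) :
    ∃ (X₁ : Scheme.{u}) (π₁ : X₁ ⟶ X), IsProper π₁ ∧ IsBirational π₁ ∧ IsIntegral X₁ ∧
      ∀ x : X₁, ∀ d : ℕ, ringKrullDim (X₁.presheaf.stalk x) = d →
        ∀ s : Fin d → X₁.presheaf.stalk x, (Ideal.span (Set.range s)).radical.IsMaximal →
          RingTheory.Sequence.IsWeaklyRegular (X₁.presheaf.stalk x) (List.ofFn s) := by
  refine ⟨X, 𝟙 X, inferInstance, ⟨⊤, ?_, ?_, ?_⟩, inferInstance, hX⟩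
  · simp
  · simp
  · infer_instance

end Literature.AlgebraicGeometry.Resolution

end
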